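import Summits.ABC.ABC.Theorems.YuMatveevShapeRatCloses
import Summits.ABC.ABC.Theorems.IneffectiveSubspaceUniformSadicTowerFourThreeSlotQuasiPolynomial
import HarnessLib

/-!
# The dyadic cell of abc is quasi-polynomial in `ω` — for EVERY `ω`, UNCONDITIONALLY

`Summits/ABC/ABC/Theorems/DyadicCellQuasiPolynomial.lean` — D-0145 ideator seat `abc-idea-3`
(generation 3, technique card «assume the opposite / build the counterexample until it breaks»),
2026-08-28.  SUPPORT file (second rung of the generation) for the few-prime cruxes
`FewPrimeUniformABC` (stmt-ABC-19049, routes `OmegaSplitFewPrime` / `ThreeSlotCyclotomicDescent`),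
`UniformSadicTowerFour` (stmt-ABC-14937) and `RigidThreeSlotABC` (stmt-ABC-23676).

THE CELL.  Call an abc triple `a + b = c` DYADIC when one of its members lies in `{1} ∪ 2^ℕ`, i.e.
`(∃ k, a = 2^k) ∨ (∃ k, b = 2^k) ∨ (∃ k, c = 2^k)`.  Every triple with `ω(abc) ≤ 3` and `a, b ≥ 2` is
dyadic (the even member of three pairwise coprime prime powers is a power of `2`), every triple with
`min(a, b) = 1` is dyadic, and so are all the classical families `2^n ± 1`, `p^x − 2^y = q^z`,
`2^x + q^y = r^z s^w …` at every `ω`.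

WHAT IS PROVED (sorry-free).
* `dyadicCell_quasiPolynomial` — IF every abc triple satisfies the three linear-forms-in-logarithms
  bounds `Pasten.arch_bound`, `Pasten.padic_bound_a`, `Pasten.padic_bound_c` at threshold `0` (stated
  verbatim as in the tree's `threeSlot_quasiPolynomial`), THEN every dyadic abc triple satisfies
  `log c ≤ (5 / (log 2)²) · K^(ω(abc)+1) · (∏_{p ∣ abc} log p) · log max(e, 2 log c)`.
* `dyadicCell_quasiPolynomial_holds` — the same with NO hypotheses, for some absolute `K ≥ 1`, by the
  kernel theorem `approximationBound_rat_holds` (rung F-A1.L, ✓ p584875).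
So on the dyadic part of every bounded-`ω` cell `{ω(abc) ≤ W}` abc is QUASI-POLYNOMIAL:
`log c ≪_W (log rad)^W · log log c` — ε-free and effective in shape — whereas the generic bound on the
same cell is Stewart–Yu's `log c ≪ rad^{1/3+o(1)}`.

HOW (one paragraph).  Parity gives `2 ∣ abc`.  If the dyadic member is `a = 1`, the archimedean form
alone gives `log c < Θ_{b,c} · Y` (`Y = log max(e, 2 log c)`, `Θ_{u,v} = K^(ω(uv)+1) ∏_{p ∣ uv} log p`).
If it is `a = 2^k` with `k ≥ 1`, the 2-ADIC form at the summand `a` has `v₂(a) = k` = the full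
exponent, and Yu's `p / log p` loss is the constant `2 / log 2`: `k log 2 < Θ_{b,c}(2/log 2)(log 2 + Y)`;
then either `b < a` (so `c < 2a = 2^(k+1)`) or `a ≤ b` and `a` is the small term of the archimedean
form.  If it is `c = 2^k`, the 2-adic form at `c` bounds `k log 2 = log c` directly.  The member `b` is
reduced to `a` by the swap symmetry.  In each case `Θ_{·,·} ≤ K^(ω(abc)+1) (∏_{p ∣ abc} log p) / log 2`
because the dyadic member contributes exactly the factor `log 2` (or nothing) to the product.

WHAT THIS IS NOT.  Not abc on the dyadic cell (the bound allows quality `≍_W (log rad)^{W-1}`); not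
new transcendence input (the three LFL shapes are the tree's); the `ω ≤ 3` case is the tree's
`threeSlot_quasiPolynomial` (whose docstring marks «anything at ω ≥ 4» as deliberately not there) —
this file is that wall one cell up, at every `ω`, and unconditional.  In the few-prime atlas it says:
a bounded-`ω` abc-violating sequence eventually has NO member in `{1} ∪ 2^ℕ`; the LFL-dark corner of
`{ω(abc) ≤ W}` is the set of triples all of whose members have an odd prime factor (for `W = 4`:
`{2^x p^y, q^z, r^w}`, cf. `RibetTakahashiSplitAbcValuationProductOmegaThree`).

Assume-the-opposite reading (why this seat files it): building the counterexample inside a bounded-`ω`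
cell, the first thing that breaks is the pure power of two — the cheapest place (`p = 2`, no `p / log p`
loss, valuation = full exponent) kills it at quasi-polynomial height.  No summit, rung or conjunct of
abc is proved here; typed ≠ proved.
-/

-- `Summit.<Summit>.<Problem>` is the mandated summit-side namespace (CONVENTIONS §2); for the
-- single-conjunct summit `ABC` the two coincide, so the duplicate `ABC.ABC` is deliberate.
set_option linter.dupNamespace false

namespace Summit.ABC.ABC.Theorems.DyadicCell

open Literature.NumberTheory.DiophantineGeometry (IsABCTriple rad)
open Literature.NumberTheory.DiophantineGeometry.Pasten
  (arch_bound padic_bound_a padic_bound_c one_le_log_max_exp coprime_right_of_isABCTriple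
    coprime_left_of_isABCTriple)
open Literature.Barriers.ABC (theta_zero_eq prod_log_primeFactors_pos)
open Summit.ABC.ABC.Theorems.UniformSadicTowerFour.ThreeSlotWall
  (log_two_le_prod_log primeFactors_abc_eq_union primeFactors_abc_eq_union' two_dvd_abc)
open Finset Real

/-! ## Real-arithmetic steps, `ω`-uniform versions of the three-slot wall's -/

/-- The 2-adic step: from Yu's shape at `p = 2` to `X ≤ (4/(log 2)²)·(K^(m+1)·L·Y)`. [folklore] -/
theorem real_two_adic_step {K L Y X : ℝ} {n m : ℕ} (hK : 1 ≤ K) (hL : 0 < L) (hY : 1 ≤ Y)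
    (hn : n ≤ m)
    (hP : X < K ^ (n + 1) * (L / Real.log 2) * ((2 / Real.log 2) * (Real.log 2 + Y))) :
    X ≤ (4 / Real.log 2 ^ 2) * (K ^ (m + 1) * L * Y) := by
  have hl2 : 0 < Real.log 2 := Real.log_pos one_lt_two
  have hl2' : Real.log 2 < 1 := Real.log_two_lt_d9.trans (by norm_num)
  have hKn : K ^ (n + 1) ≤ K ^ (m + 1) := pow_le_pow_right₀ hK (by omega)
  have hY0 : 0 ≤ Y := zero_le_one.trans hY
  have hLl : 0 ≤ L / Real.log 2 := by positivity
  have h2Y : Real.log 2 + Y ≤ 2 * Y := by linarith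
  have h1 : K ^ (n + 1) * (L / Real.log 2) * ((2 / Real.log 2) * (Real.log 2 + Y)) ≤
      K ^ (m + 1) * (L / Real.log 2) * ((2 / Real.log 2) * (2 * Y)) := by
    gcongr
  have h2 : K ^ (m + 1) * (L / Real.log 2) * ((2 / Real.log 2) * (2 * Y)) =
      (4 / Real.log 2 ^ 2) * (K ^ (m + 1) * L * Y) := by
    field_simp
    ring
  linarith

/-- The archimedean step: `D ≤ (1/log 2)·(K^(m+1)·L·Y)`. [folklore] -/
theorem real_arch_step {K L Y D : ℝ} {n m : ℕ} (hK : 1 ≤ K) (hL : 0 < L) (hY : 1 ≤ Y) (hn : n ≤ m)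
    (hA : D < K ^ (n + 1) * (L / Real.log 2) * Y) :
    D ≤ (1 / Real.log 2) * (K ^ (m + 1) * L * Y) := by
  have hl2 : 0 < Real.log 2 := Real.log_pos one_lt_two
  have hKn : K ^ (n + 1) ≤ K ^ (m + 1) := pow_le_pow_right₀ hK (by omega)
  have hY0 : 0 ≤ Y := zero_le_one.trans hY
  have hLl : 0 ≤ L / Real.log 2 := by positivity
  have h1 : K ^ (n + 1) * (L / Real.log 2) * Y ≤ K ^ (m + 1) * (L / Real.log 2) * Y := by gcongr
  have h2 : K ^ (m + 1) * (L / Real.log 2) * Y = (1 / Real.log 2) * (K ^ (m + 1) * L * Y) := by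
    field_simp
  linarith

/-! ## Powers of two -/

/-- `log 2^k = k · log 2` for the natural number `2^k` cast to `ℝ`. [folklore] -/
theorem log_two_pow (k : ℕ) : Real.log ((2 ^ k : ℕ) : ℝ) = (k : ℝ) * Real.log 2 := by
  push_cast
  exact Real.log_pow 2 k

/-- `v₂(2^k) = k`. [folklore] -/
theorem factorization_two_pow (k : ℕ) : (2 ^ k : ℕ).factorization 2 = k := by
  rw [Nat.factorization_pow, Finsupp.smul_apply, Nat.Prime.factorization_self Nat.prime_two,
    smul_eq_mul, mul_one]

/-! ## The wall on the dyadic cell -/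

/-- **Quasi-polynomial abc on the dyadic cell, every `ω`.**  Hypotheses = the archimedean and the two
`p`-adic linear-forms bounds (`Pasten.arch_bound`, `padic_bound_a`, `padic_bound_c` at threshold `0`,
`theta_zero_eq`), verbatim as in `threeSlot_quasiPolynomial`.  Conclusion: every abc triple with a
member in `{1} ∪ 2^ℕ` has
`log c ≤ (5/(log 2)²) · K^(ω(abc)+1) · (∏_{p ∣ abc} log p) · log max(e, 2 log c)`. [folklore]
[cite: StewartYu2001, Theorem 1 (method)] [cite: Pasten2024, Theorem 2.1 (d = 1)] -/
theorem dyadicCell_quasiPolynomial (K : ℝ) (hK : 1 ≤ K)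
    (hArch : ∀ a b c : ℕ, IsABCTriple a b c →
      Real.log c - Real.log a < K ^ ((b * c).primeFactors.card + 1) *
        (∏ p ∈ (b * c).primeFactors, Real.log p) * Real.log (max (Real.exp 1) (2 * Real.log c)))
    (hPa : ∀ a b c : ℕ, IsABCTriple a b c → ∀ p : ℕ, p.Prime → p ∣ a →
      (a.factorization p : ℝ) * Real.log p < K ^ ((b * c).primeFactors.card + 1) *
        (∏ q ∈ (b * c).primeFactors, Real.log q) *
        ((p / Real.log p) * (Real.log p + Real.log (max (Real.exp 1) (2 * Real.log c)))))
    (hPc : ∀ a b c : ℕ, IsABCTriple a b c → 1 < a * b → ∀ p : ℕ, p.Prime → p ∣ c →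
      (c.factorization p : ℝ) * Real.log p < K ^ ((a * b).primeFactors.card + 1) *
        (∏ q ∈ (a * b).primeFactors, Real.log q) *
        ((p / Real.log p) * (Real.log p + Real.log (max (Real.exp 1) (2 * Real.log c))))) :
    ∀ a b c : ℕ, IsABCTriple a b c →
      ((∃ k : ℕ, a = 2 ^ k) ∨ (∃ k : ℕ, b = 2 ^ k) ∨ (∃ k : ℕ, c = 2 ^ k)) →
      Real.log c ≤ (5 / Real.log 2 ^ 2) * K ^ ((a * b * c).primeFactors.card + 1) *
        (∏ p ∈ (a * b * c).primeFactors, Real.log p) *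
        Real.log (max (Real.exp 1) (2 * Real.log c)) := by
  have hl2 : 0 < Real.log 2 := Real.log_pos one_lt_two
  have hl2' : Real.log 2 < 1 := Real.log_two_lt_d9.trans (by norm_num)
  have hsq0 : 0 < Real.log 2 ^ 2 := by positivity
  have hsq : Real.log 2 ^ 2 ≤ Real.log 2 := by nlinarith
  have h1le : 1 / Real.log 2 ≤ 1 / Real.log 2 ^ 2 := one_div_le_one_div_of_le hsq0 hsq
  -- KEY STEP, for a triple whose dyadic member is `a` or `c`.
  have key : ∀ a b c : ℕ, IsABCTriple a b c → ((∃ k : ℕ, a = 2 ^ k) ∨ (∃ k : ℕ, c = 2 ^ k)) →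
      Real.log c ≤ (5 / Real.log 2 ^ 2) * K ^ ((a * b * c).primeFactors.card + 1) *
        (∏ p ∈ (a * b * c).primeFactors, Real.log p) *
        Real.log (max (Real.exp 1) (2 * Real.log c)) := by
    intro a b c h h2
    have hprimes : ∀ p ∈ (a * b * c).primeFactors, p.Prime :=
      fun p hp => Nat.prime_of_mem_primeFactors hp
    set m : ℕ := (a * b * c).primeFactors.card with hmdef
    set L : ℝ := ∏ p ∈ (a * b * c).primeFactors, Real.log p with hLdef
    set Y : ℝ := Real.log (max (Real.exp 1) (2 * Real.log c)) with hYdef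
    have hY : 1 ≤ Y := one_le_log_max_exp _
    have hY0 : 0 ≤ Y := zero_le_one.trans hY
    have hLpos : 0 < L := prod_log_primeFactors_pos _
    have hKm : 1 ≤ K ^ (m + 1) := one_le_pow₀ hK
    obtain ⟨P, hP⟩ : ∃ P : ℝ, P = K ^ (m + 1) * L * Y := ⟨_, rfl⟩
    have hLY0 : 0 ≤ L * Y := mul_nonneg hLpos.le hY0
    have hLYP : L * Y ≤ P := by
      have := mul_le_mul_of_nonneg_right hKm hLY0
      rw [one_mul] at this
      rw [hP, mul_assoc]
      exact this
    have hP0 : 0 ≤ P := hLY0.trans hLYP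
    have hPl : P ≤ P / Real.log 2 ^ 2 := by
      rw [le_div_iff₀ hsq0]
      exact mul_le_of_le_one_right hP0 (hsq.trans hl2'.le)
    have hP1 : (1 / Real.log 2) * P ≤ (1 / Real.log 2 ^ 2) * P :=
      mul_le_mul_of_nonneg_right h1le hP0
    have etarget : (5 / Real.log 2 ^ 2) * K ^ (m + 1) * L * Y = 5 * (P / Real.log 2 ^ 2) := by
      rw [hP]; ring
    have e4 : (4 / Real.log 2 ^ 2) * (K ^ (m + 1) * L * Y) = 4 * (P / Real.log 2 ^ 2) := by
      rw [hP]; ring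
    have e1 : (1 / Real.log 2 ^ 2) * P = P / Real.log 2 ^ 2 := by ring
    rw [etarget]
    obtain ⟨ha, hb, habc, hcop⟩ := h
    have hc : 0 < c := by omega
    have habc0 : a * b * c ≠ 0 := by positivity
    have h2abc : 2 ∣ a * b * c := by
      rcases two_dvd_abc ⟨ha, hb, habc, hcop⟩ with h2 | h2 | h2
      · exact Dvd.dvd.mul_right (Dvd.dvd.mul_right h2 b) c
      · exact Dvd.dvd.mul_right (Dvd.dvd.mul_left h2 a) c
      · exact Dvd.dvd.mul_left h2 (a * b)
    have hL2 : Real.log 2 ≤ L :=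
      log_two_le_prod_log hprimes (Nat.mem_primeFactors.mpr ⟨Nat.prime_two, h2abc, habc0⟩)
    have hLY : Real.log 2 ≤ L * Y := by nlinarith
    have h2P : Real.log 2 ≤ P := hLY.trans hLYP
    rcases h2 with ⟨k, rfl⟩ | ⟨k, rfl⟩
    · -- the dyadic member is the summand `a = 2^k`
      rcases Nat.eq_zero_or_pos k with rfl | hk
      · -- `a = 1`: the archimedean bound alone
        have hA := hArch (2 ^ 0) b c ⟨ha, hb, habc, hcop⟩
        rw [pow_zero, Nat.cast_one, Real.log_one, sub_zero] at hA
        have hbc : (b * c).primeFactors = (2 ^ 0 * b * c).primeFactors := by rw [pow_zero, one_mul]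
        rw [hbc] at hA
        have hA' : Real.log c < P := by rw [hP]; exact hA
        linarith
      · -- `a = 2^k`, `k ≥ 1`: 2-adic bound on `k`, then archimedean or domination
        have hapf : (2 ^ k : ℕ).primeFactors = {2} := Nat.primeFactors_prime_pow hk.ne' Nat.prime_two
        have hloga : Real.log ((2 ^ k : ℕ) : ℝ) = (k : ℝ) * Real.log 2 := log_two_pow k
        have hPad := hPa (2 ^ k) b c ⟨ha, hb, habc, hcop⟩ 2 Nat.prime_two (dvd_pow_self 2 hk.ne')
        rw [factorization_two_pow] at hPad
        simp only [Nat.cast_ofNat] at hPad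
        obtain ⟨hU, hD⟩ := primeFactors_abc_eq_union ⟨ha, hb, habc, hcop⟩
        have hLsplit : L = Real.log 2 * ∏ p ∈ (b * c).primeFactors, Real.log p := by
          rw [hLdef, hU, Finset.prod_union hD, hapf, Finset.prod_singleton, Nat.cast_ofNat]
        have hPeq : ∏ p ∈ (b * c).primeFactors, Real.log p = L / Real.log 2 := by
          rw [hLsplit]; field_simp
        have hcardbc : (b * c).primeFactors.card ≤ m := by
          have : m = 1 + (b * c).primeFactors.card := by
            rw [hmdef, hU, Finset.card_union_of_disjoint hD, hapf, Finset.card_singleton]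
          omega
        rw [hPeq] at hPad
        have hkb := real_two_adic_step hK hLpos hY hcardbc hPad
        rw [e4] at hkb
        rcases le_or_gt (2 ^ k) b with hab | hab
        · -- `a ≤ b`: `a` is the small term of the archimedean bound
          have hA := hArch (2 ^ k) b c ⟨ha, hb, habc, hcop⟩
          rw [hPeq] at hA
          have hA' := real_arch_step hK hLpos hY hcardbc hA
          rw [hloga, ← hP] at hA'
          linarith
        · -- `b < a`: then `c = a + b < 2a = 2^(k+1)`
          have hc2a : (c : ℝ) < 2 * ((2 ^ k : ℕ) : ℝ) := by
            exact_mod_cast (show c < 2 * 2 ^ k by omega)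
          have ha0 : (0 : ℝ) < ((2 ^ k : ℕ) : ℝ) := by exact_mod_cast ha
          have hlogc : Real.log c < Real.log 2 + (k : ℝ) * Real.log 2 := by
            rw [← hloga, ← Real.log_mul (by norm_num) ha0.ne']
            exact Real.log_lt_log (by exact_mod_cast hc) hc2a
          linarith
    · -- the dyadic member is `c = 2^k`
      have hk : k ≠ 0 := by
        rintro rfl
        simp only [pow_zero] at habc
        omega
      have hcpf : (2 ^ k : ℕ).primeFactors = {2} := Nat.primeFactors_prime_pow hk Nat.prime_two
      have hlogc : Real.log ((2 ^ k : ℕ) : ℝ) = (k : ℝ) * Real.log 2 := log_two_pow k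
      by_cases hab1 : a * b ≤ 1
      · -- `a = b = 1`, `c = 2`: `log c = log 2 ≤ L ≤ P`
        have ha1 : a = 1 := by nlinarith
        have hb1 : b = 1 := by nlinarith
        subst ha1; subst hb1
        have hc2 : ((2 ^ k : ℕ) : ℝ) = 2 := by exact_mod_cast habc.symm
        rw [hc2]
        linarith
      · push Not at hab1
        have hPcd := hPc a b (2 ^ k) ⟨ha, hb, habc, hcop⟩ hab1 2 Nat.prime_two (dvd_pow_self 2 hk)
        rw [factorization_two_pow] at hPcd
        simp only [Nat.cast_ofNat] at hPcd
        obtain ⟨hU, hD⟩ := primeFactors_abc_eq_union' ⟨ha, hb, habc, hcop⟩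
        have hLsplit : L = (∏ p ∈ (a * b).primeFactors, Real.log p) * Real.log 2 := by
          rw [hLdef, hU, Finset.prod_union hD, hcpf, Finset.prod_singleton, Nat.cast_ofNat]
        have hPeq : ∏ p ∈ (a * b).primeFactors, Real.log p = L / Real.log 2 := by
          rw [hLsplit]; field_simp
        have hcardab : (a * b).primeFactors.card ≤ m := by
          have : m = (a * b).primeFactors.card + 1 := by
            rw [hmdef, hU, Finset.card_union_of_disjoint hD, hcpf, Finset.card_singleton]
          omega
        rw [hPeq] at hPcd
        have hkb := real_two_adic_step hK hLpos hY hcardab hPcd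
        rw [e4] at hkb
        rw [hlogc]
        linarith
  -- MAIN: the dyadic member is `a`, `b` or `c`; if it is `b`, swap the summands.
  intro a b c h h2
  rcases h2 with h2 | h2 | h2
  · exact key a b c h (Or.inl h2)
  · have hswap : b * a * c = a * b * c := by ring
    have := key b a c h.swap (Or.inl h2)
    rwa [hswap] at this
  · exact key a b c h (Or.inr h2)

/-! ## Unconditional discharge (library effect of rung F-A1.L) -/

/-- **Quasi-polynomial abc on the dyadic cell, every `ω`, unconditionally**: there is an absolute
`K ≥ 1` such that every abc triple with a member in `{1} ∪ 2^ℕ` satisfies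
`log c ≤ (5/(log 2)²) · K^(ω(abc)+1) · (∏_{p ∣ abc} log p) · log max(e, 2 log c)`.
`dyadicCell_quasiPolynomial` with its three hypotheses discharged by `approximationBound_rat_holds`.
[folklore] assembly [cite: Pasten2024, Theorem 2.1 (d = 1)] [cite: StewartYu2001, Theorem 1 (method)] -/
theorem dyadicCell_quasiPolynomial_holds :
    ∃ K : ℝ, 1 ≤ K ∧ ∀ a b c : ℕ, IsABCTriple a b c →
      ((∃ k : ℕ, a = 2 ^ k) ∨ (∃ k : ℕ, b = 2 ^ k) ∨ (∃ k : ℕ, c = 2 ^ k)) →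
      Real.log c ≤ (5 / Real.log 2 ^ 2) * K ^ ((a * b * c).primeFactors.card + 1) *
        (∏ p ∈ (a * b * c).primeFactors, Real.log p) *
        Real.log (max (Real.exp 1) (2 * Real.log c)) := by
  obtain ⟨K, hK, hP⟩ := approximationBound_rat_holds
  refine ⟨K, hK, dyadicCell_quasiPolynomial K hK ?_ ?_ ?_⟩
  · intro a b c h
    have hc : c ≠ 0 := by obtain ⟨ha, -, habc, -⟩ := h; omega
    have := arch_bound hK hP h 0
    rwa [theta_zero_eq K h.2.1.ne' hc (coprime_right_of_isABCTriple h)] at this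
  · intro a b c h p hp hpa
    have hc : c ≠ 0 := by obtain ⟨ha, -, habc, -⟩ := h; omega
    have := padic_bound_a hK hP h 0 hp hpa
    rwa [theta_zero_eq K h.2.1.ne' hc (coprime_right_of_isABCTriple h)] at this
  · intro a b c h h1 p hp hpc
    have := padic_bound_c hK hP h h1 0 hp hpc
    rwa [theta_zero_eq K h.1.ne' h.2.1.ne' h.2.2.2] at this

/-- **Bounded-`ω` corollary (the few-prime atlas form).**  For every `W` there is `C > 0` with
`log c ≤ C · (∏_{p ∣ abc} log p) · log max(e, 2 log c)` for every DYADIC abc triple with `ω(abc) ≤ W`: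
on the dyadic part of each bounded-`ω` cell abc is quasi-polynomial, `log c ≪_W (log rad)^W log log c`.
[folklore] -/
theorem dyadicCell_boundedOmega_quasiPolynomial (W : ℕ) :
    ∃ C : ℝ, 0 < C ∧ ∀ a b c : ℕ, IsABCTriple a b c → (a * b * c).primeFactors.card ≤ W →
      ((∃ k : ℕ, a = 2 ^ k) ∨ (∃ k : ℕ, b = 2 ^ k) ∨ (∃ k : ℕ, c = 2 ^ k)) →
      Real.log c ≤ C * (∏ p ∈ (a * b * c).primeFactors, Real.log p) *
        Real.log (max (Real.exp 1) (2 * Real.log c)) := by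
  obtain ⟨K, hK, hmain⟩ := dyadicCell_quasiPolynomial_holds
  have hl2 : 0 < Real.log 2 := Real.log_pos one_lt_two
  have hK0 : 0 < K := one_pos.trans_le hK
  refine ⟨(5 / Real.log 2 ^ 2) * K ^ (W + 1), by positivity, fun a b c h hW hd => ?_⟩
  have h1 := hmain a b c h hd
  have hKW : K ^ ((a * b * c).primeFactors.card + 1) ≤ K ^ (W + 1) :=
    pow_le_pow_right₀ hK (by omega)
  have hL : 0 < ∏ p ∈ (a * b * c).primeFactors, Real.log p := prod_log_primeFactors_pos _
  have hY : 1 ≤ Real.log (max (Real.exp 1) (2 * Real.log c)) := one_le_log_max_exp _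
  have hLY : 0 ≤ (∏ p ∈ (a * b * c).primeFactors, Real.log p) *
      Real.log (max (Real.exp 1) (2 * Real.log c)) := mul_nonneg hL.le (zero_le_one.trans hY)
  have h2 : (5 / Real.log 2 ^ 2) * K ^ ((a * b * c).primeFactors.card + 1) *
      (∏ p ∈ (a * b * c).primeFactors, Real.log p) * Real.log (max (Real.exp 1) (2 * Real.log c)) ≤
      (5 / Real.log 2 ^ 2) * K ^ (W + 1) *
      (∏ p ∈ (a * b * c).primeFactors, Real.log p) * Real.log (max (Real.exp 1) (2 * Real.log c)) := by
    have hA : (0 : ℝ) ≤ 5 / Real.log 2 ^ 2 := by positivity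
    have h3 := mul_le_mul_of_nonneg_right (mul_le_mul_of_nonneg_left hKW hA) hLY
    simpa only [mul_assoc] using h3
  exact h1.trans h2

end Summit.ABC.ABC.Theorems.DyadicCell
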